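import Summits.Ventures.WeilGRH.DualTrigUniversalEvenLog8HalfQ16
import Summits.Ventures.WeilGRH.DualTrigUniversalOddLog8Half
import Summits.Ventures.WeilGRH.DualTrigUniversalOddLog8HalfQ6
import HarnessLib

/-!
# Weil positivity at `t = 1` (and `t = (log 8)/2`) for EVERY Dirichlet character of EVERY modulus `q ≥ 500`

Cell `rh-explicit`, WEIL TRACK — GRH ARM, route B (weil-grh-3, gen5).  Parity-free assembly of the two universal
(archimedean-only) format-D-K certificates at the LP-tight constants, `ucert_even_8q16` (`q_c = 16`,
`DualTrigUniversalEvenLog8HalfQ16.lean`) / `ucert_odd_8q6` (`q_c = 6`, `DualTrigUniversalOddLog8HalfQ6.lean`; the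
`30 ∣ q` odd rung is the one of `DualTrigUniversalOddLog8Half.lean`): the parity `a_χ ∈ {0, 1}` (`charParity_le_one`)
selects the certificate; the threshold is the larger (even-parity) one.  Thresholds by the divisibility pattern of the
modulus (a prime `p ∣ q` kills the window terms `n = p^e`, lowering the sliver budget `B_N(q)`):

* all moduli: `q ≥ 500`;  2 ∣ q: `q ≥ 135`;  3 ∣ q: `q ≥ 270`;
* 2 ∣ q · 3 ∣ q: `q ≥ 72`;  2 ∣ q · 3 ∣ q · 5 ∣ q: `q ≥ 36`;  2 ∣ q · 3 ∣ q · 5 ∣ q · 7 ∣ q: `q ≥ 16`;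

and since `1 ≤ (log 8)/2`, the same at `t = 1`.  WHAT IS NEW HERE: (i) the window `t = (log 8)/2 = 1.0397 ⊋ 1` uniformly in
the character (the tree's certificate-free floors — `UniformConductorFloorCellsEightyFloors`, `q ≥ 144 / odd 56`, and the
joint floor `DualTrigUniversalJointOneC`, `q ≥ 129` — are stated at `t = 1`); (ii) at `t = 1`, the DIVISIBILITY floors below the
uniform ones: every character mod `q` with `6 ∣ q`, `q ≥ 72` (`q = 72, 78, …, 126`) and with `30 ∣ q`, `q ≥ 36` (`q = 60, 90, 120`).
The plain threshold `500` is weaker than the tree's `144` at `t = 1` and is kept only for the `(log 8)/2` window.  No value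
`χ(p)` is used (reach law of key-free multiplier certificates, `log q ≥ B_N(q) − ℓ_a(t)`).  No named facts, no `sorry`.
-/

namespace Summit.Ventures.WeilGRH

open Literature.NumberTheory.LFunctions

/-- **Weil positivity on `[−t, t]`, `t = (log 8)/2 = 1.0397`, for EVERY Dirichlet character of EVERY modulus `q ≥ 500`.**
(even parity from `q ≥ 500`, odd from `q ≥ 192`; archimedean-only kernel certificates, no hypothesis on `χ`). [folklore] -/
theorem weilPositivityOnChar_log8half_of_ge_500 {q : ℕ} (hq : 500 ≤ q)  (χ : DirichletCharacter ℂ q) :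
    WeilPositivityOnChar χ (Real.log 8 / 2) := by
  have hle := charParity_le_one χ
  rcases Nat.lt_or_ge (charParity χ) 1 with h | h
  · exact weilPositivityOnChar_log8half_of_even_ge_500 (by omega)  χ (by omega)
  · exact weilPositivityOnChar_log8half_of_odd_ge_192 (by omega)  χ (by omega)

/-- **The `t = 1` rung for EVERY Dirichlet character of EVERY modulus `q ≥ 500`**: `WeilPositivityOnChar χ 1`. [folklore] -/
theorem weilPositivityOnChar_one_of_ge_500 {q : ℕ} (hq : 500 ≤ q)  (χ : DirichletCharacter ℂ q) :
    WeilPositivityOnChar χ 1 := by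
  refine WeilPositivityOnChar.mono ?_ (weilPositivityOnChar_log8half_of_ge_500 hq  χ)
  have h8 : Real.log 8 = 3 * Real.log 2 := by
    rw [show (8 : ℝ) = 2 ^ 3 by norm_num, Real.log_pow]; push_cast; ring
  rw [h8]
  linarith [Real.log_two_gt_d9]

/-- **Weil positivity on `[−t, t]`, `t = (log 8)/2 = 1.0397`, for EVERY Dirichlet character of EVERY modulus `q ≥ 135` with `2 ∣ q`.**
(even parity from `q ≥ 135`, odd from `q ≥ 50`; archimedean-only kernel certificates, no hypothesis on `χ`). [folklore] -/
theorem weilPositivityOnChar_log8half_of_ge_135_of_two_dvd {q : ℕ} (hq : 135 ≤ q) (h2 : 2 ∣ q) (χ : DirichletCharacter ℂ q) :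
    WeilPositivityOnChar χ (Real.log 8 / 2) := by
  have hle := charParity_le_one χ
  rcases Nat.lt_or_ge (charParity χ) 1 with h | h
  · exact weilPositivityOnChar_log8half_of_even_ge_135_of_two_dvd (by omega) h2 χ (by omega)
  · exact weilPositivityOnChar_log8half_of_odd_ge_50_of_two_dvd (by omega) h2 χ (by omega)

/-- **The `t = 1` rung for EVERY Dirichlet character of EVERY modulus `q ≥ 135` with `2 ∣ q`**: `WeilPositivityOnChar χ 1`. [folklore] -/
theorem weilPositivityOnChar_one_of_ge_135_of_two_dvd {q : ℕ} (hq : 135 ≤ q) (h2 : 2 ∣ q) (χ : DirichletCharacter ℂ q) :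
    WeilPositivityOnChar χ 1 := by
  refine WeilPositivityOnChar.mono ?_ (weilPositivityOnChar_log8half_of_ge_135_of_two_dvd hq h2 χ)
  have h8 : Real.log 8 = 3 * Real.log 2 := by
    rw [show (8 : ℝ) = 2 ^ 3 by norm_num, Real.log_pow]; push_cast; ring
  rw [h8]
  linarith [Real.log_two_gt_d9]

/-- **Weil positivity on `[−t, t]`, `t = (log 8)/2 = 1.0397`, for EVERY Dirichlet character of EVERY modulus `q ≥ 270` with `3 ∣ q`.**
(even parity from `q ≥ 270`, odd from `q ≥ 100`; archimedean-only kernel certificates, no hypothesis on `χ`). [folklore] -/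
theorem weilPositivityOnChar_log8half_of_ge_270_of_three_dvd {q : ℕ} (hq : 270 ≤ q) (h3 : 3 ∣ q) (χ : DirichletCharacter ℂ q) :
    WeilPositivityOnChar χ (Real.log 8 / 2) := by
  have hle := charParity_le_one χ
  rcases Nat.lt_or_ge (charParity χ) 1 with h | h
  · exact weilPositivityOnChar_log8half_of_even_ge_270_of_three_dvd (by omega) h3 χ (by omega)
  · exact weilPositivityOnChar_log8half_of_odd_ge_100_of_three_dvd (by omega) h3 χ (by omega)

/-- **The `t = 1` rung for EVERY Dirichlet character of EVERY modulus `q ≥ 270` with `3 ∣ q`**: `WeilPositivityOnChar χ 1`. [folklore] -/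
theorem weilPositivityOnChar_one_of_ge_270_of_three_dvd {q : ℕ} (hq : 270 ≤ q) (h3 : 3 ∣ q) (χ : DirichletCharacter ℂ q) :
    WeilPositivityOnChar χ 1 := by
  refine WeilPositivityOnChar.mono ?_ (weilPositivityOnChar_log8half_of_ge_270_of_three_dvd hq h3 χ)
  have h8 : Real.log 8 = 3 * Real.log 2 := by
    rw [show (8 : ℝ) = 2 ^ 3 by norm_num, Real.log_pow]; push_cast; ring
  rw [h8]
  linarith [Real.log_two_gt_d9]

/-- **Weil positivity on `[−t, t]`, `t = (log 8)/2 = 1.0397`, for EVERY Dirichlet character of EVERY modulus `q ≥ 72` with `2 ∣ q`, `3 ∣ q`.**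
(even parity from `q ≥ 72`, odd from `q ≥ 27`; archimedean-only kernel certificates, no hypothesis on `χ`). [folklore] -/
theorem weilPositivityOnChar_log8half_of_ge_72_of_six_dvd {q : ℕ} (hq : 72 ≤ q) (h2 : 2 ∣ q) (h3 : 3 ∣ q) (χ : DirichletCharacter ℂ q) :
    WeilPositivityOnChar χ (Real.log 8 / 2) := by
  have hle := charParity_le_one χ
  rcases Nat.lt_or_ge (charParity χ) 1 with h | h
  · exact weilPositivityOnChar_log8half_of_even_ge_72_of_six_dvd (by omega) h2 h3 χ (by omega)
  · exact weilPositivityOnChar_log8half_of_odd_ge_27_of_six_dvd (by omega) h2 h3 χ (by omega)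

/-- **The `t = 1` rung for EVERY Dirichlet character of EVERY modulus `q ≥ 72` with `2 ∣ q`, `3 ∣ q`**: `WeilPositivityOnChar χ 1`. [folklore] -/
theorem weilPositivityOnChar_one_of_ge_72_of_six_dvd {q : ℕ} (hq : 72 ≤ q) (h2 : 2 ∣ q) (h3 : 3 ∣ q) (χ : DirichletCharacter ℂ q) :
    WeilPositivityOnChar χ 1 := by
  refine WeilPositivityOnChar.mono ?_ (weilPositivityOnChar_log8half_of_ge_72_of_six_dvd hq h2 h3 χ)
  have h8 : Real.log 8 = 3 * Real.log 2 := by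
    rw [show (8 : ℝ) = 2 ^ 3 by norm_num, Real.log_pow]; push_cast; ring
  rw [h8]
  linarith [Real.log_two_gt_d9]

/-- **Weil positivity on `[−t, t]`, `t = (log 8)/2 = 1.0397`, for EVERY Dirichlet character of EVERY modulus `q ≥ 36` with `2 ∣ q`, `3 ∣ q`, `5 ∣ q`.**
(even parity from `q ≥ 36`, odd from `q ≥ 15`; archimedean-only kernel certificates, no hypothesis on `χ`). [folklore] -/
theorem weilPositivityOnChar_log8half_of_ge_36_of_thirty_dvd {q : ℕ} (hq : 36 ≤ q) (h2 : 2 ∣ q) (h3 : 3 ∣ q) (h5 : 5 ∣ q) (χ : DirichletCharacter ℂ q) :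
    WeilPositivityOnChar χ (Real.log 8 / 2) := by
  have hle := charParity_le_one χ
  rcases Nat.lt_or_ge (charParity χ) 1 with h | h
  · exact weilPositivityOnChar_log8half_of_even_ge_36_of_thirty_dvd (by omega) h2 h3 h5 χ (by omega)
  · exact weilPositivityOnChar_log8half_of_odd_ge_15_of_thirty_dvd (by omega) h2 h3 h5 χ (by omega)

/-- **The `t = 1` rung for EVERY Dirichlet character of EVERY modulus `q ≥ 36` with `2 ∣ q`, `3 ∣ q`, `5 ∣ q`**: `WeilPositivityOnChar χ 1`. [folklore] -/
theorem weilPositivityOnChar_one_of_ge_36_of_thirty_dvd {q : ℕ} (hq : 36 ≤ q) (h2 : 2 ∣ q) (h3 : 3 ∣ q) (h5 : 5 ∣ q) (χ : DirichletCharacter ℂ q) :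
    WeilPositivityOnChar χ 1 := by
  refine WeilPositivityOnChar.mono ?_ (weilPositivityOnChar_log8half_of_ge_36_of_thirty_dvd hq h2 h3 h5 χ)
  have h8 : Real.log 8 = 3 * Real.log 2 := by
    rw [show (8 : ℝ) = 2 ^ 3 by norm_num, Real.log_pow]; push_cast; ring
  rw [h8]
  linarith [Real.log_two_gt_d9]

/-- **Weil positivity on `[−t, t]`, `t = (log 8)/2 = 1.0397`, for EVERY Dirichlet character of EVERY modulus `q ≥ 16` with `2 ∣ q`, `3 ∣ q`, `5 ∣ q`, `7 ∣ q`.**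
(even parity from `q ≥ 16`, odd from `q ≥ 6`; archimedean-only kernel certificates, no hypothesis on `χ`). [folklore] -/
theorem weilPositivityOnChar_log8half_of_ge_16_of_twohundredten_dvd {q : ℕ} (hq : 16 ≤ q) (h2 : 2 ∣ q) (h3 : 3 ∣ q) (h5 : 5 ∣ q) (h7 : 7 ∣ q) (χ : DirichletCharacter ℂ q) :
    WeilPositivityOnChar χ (Real.log 8 / 2) := by
  have hle := charParity_le_one χ
  rcases Nat.lt_or_ge (charParity χ) 1 with h | h
  · exact weilPositivityOnChar_log8half_of_even_ge_16_of_twohundredten_dvd (by omega) h2 h3 h5 h7 χ (by omega)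
  · exact weilPositivityOnChar_log8half_of_odd_ge_6_of_twohundredten_dvd (by omega) h2 h3 h5 h7 χ (by omega)

/-- **The `t = 1` rung for EVERY Dirichlet character of EVERY modulus `q ≥ 16` with `2 ∣ q`, `3 ∣ q`, `5 ∣ q`, `7 ∣ q`**: `WeilPositivityOnChar χ 1`. [folklore] -/
theorem weilPositivityOnChar_one_of_ge_16_of_twohundredten_dvd {q : ℕ} (hq : 16 ≤ q) (h2 : 2 ∣ q) (h3 : 3 ∣ q) (h5 : 5 ∣ q) (h7 : 7 ∣ q) (χ : DirichletCharacter ℂ q) :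
    WeilPositivityOnChar χ 1 := by
  refine WeilPositivityOnChar.mono ?_ (weilPositivityOnChar_log8half_of_ge_16_of_twohundredten_dvd hq h2 h3 h5 h7 χ)
  have h8 : Real.log 8 = 3 * Real.log 2 := by
    rw [show (8 : ℝ) = 2 ^ 3 by norm_num, Real.log_pow]; push_cast; ring
  rw [h8]
  linarith [Real.log_two_gt_d9]

end Summit.Ventures.WeilGRH
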